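import Mathlib
import Summits.Ventures.PercRepro2.CoinChainReduction
import Summits.Ventures.PercRepro2.CoinChainHeadHyps
import Summits.Ventures.PercRepro2.CoinK2HeadBlindArcs
import Summits.Ventures.PercRepro2.CoinTreeCore
import Summits.Ventures.PercRepro2.CoinChainBlind

/-!
# Row 2′DARC at the pure AND-switch chain with head-blind non-entries
(blind cell PercRepro2, night-2 g20; proofs/NIGHT2-DARC.md §60)

`darc_of_pureChain_of_blind`: the pure chain (`a'` entered from `ent' ⊆ U` by sure coins, `a`
from `a'` by one coin, the cluster law of `U` log-supermodular, markers anywhere in `U`) satisfies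
row 2′DARC at the free arc `a → w` whenever every NON-ENTRY core vertex has all its out-arcs
inside the core `U ∪ {a', a}` (it is head-blind).  Contains `ent' = U` (every core vertex an
entry — the covering chain without the covering hypothesis) and the two named open instances of
§59 (a head-blind non-entry marker; an uncovered head-blind entry).

PROOF.  `coreAvoidEvent_blind` turns the arc hypothesis into `chainC W = chainC (W ∩ ent')` on
`U.powerset` (and the same for `chainD`, `chainD'`); the head data restricted to `U`
(`· ∩ U`) then satisfy the hypotheses of `pureChain_functional_nonneg_of_blind` with the virtual
vertex `x₀ := a'`, the point markers, and the seven sums agree with those of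
`pureChain_darc_of_functional`.
-/

namespace Summit.Ventures.PercRepro2.Coin

open Classical

section ChainBlindDarc

variable {V : Type*} {E : Type*} [Fintype V] [DecidableEq V] [Fintype E] [DecidableEq E]
  {R : Type*} [Field R] [LinearOrder R] [IsStrictOrderedRing R]
  {arcs : E → Finset (V × V)} {s : V} {U : Finset V} {ent' : Finset V} {c' : V → E} {a' a w : V}
  {c : V → E}

omit [Fintype V] [Fintype E] [DecidableEq E] in
/-- The entry trace of the `a'`-closure is the `a'`-closure of the entry trace. -/
lemma chainPhi_inter_entries (ha'U : a' ∉ U) {W : Finset V} (hW : W ⊆ U) :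
    chainPhi ent' a' W ∩ insert a' ent' = chainPhi ent' a' (W ∩ ent') := by
  have ha'W : a' ∉ W := fun h => ha'U (hW h)
  have hiff : (∃ r ∈ ent', r ∈ W ∩ ent') ↔ (∃ r ∈ ent', r ∈ W) := by
    constructor
    · rintro ⟨r, hr, hrW⟩; exact ⟨r, hr, (Finset.mem_inter.1 hrW).1⟩
    · rintro ⟨r, hr, hrW⟩; exact ⟨r, hr, Finset.mem_inter.2 ⟨hrW, hr⟩⟩
  unfold chainPhi
  by_cases h : ∃ r ∈ ent', r ∈ W
  · rw [if_pos h, if_pos (hiff.2 h)]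
    ext v
    simp only [Finset.mem_inter, Finset.mem_union, Finset.mem_singleton, Finset.mem_insert]
    tauto
  · rw [if_neg h, if_neg (fun h' => h (hiff.1 h'))]
    ext v
    simp only [Finset.mem_inter, Finset.mem_insert]
    constructor
    · rintro ⟨hvW, hv | hv⟩
      · exact absurd (hv ▸ hvW) ha'W
      · exact ⟨hvW, hv⟩
    · rintro ⟨hvW, hv⟩; exact ⟨hvW, Or.inr hv⟩

omit [Fintype V] [Fintype E] [DecidableEq E] in
/-- The `a'`-closure of a cluster of `U` lies in `insert a' U`. -/
lemma chainPhi_subset_insert {W : Finset V} (hW : W ⊆ U) :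
    chainPhi ent' a' W ⊆ insert a' U := by
  unfold chainPhi
  split_ifs
  · exact Finset.union_subset (hW.trans (Finset.subset_insert _ _))
      (by simp only [Finset.singleton_subset_iff, Finset.mem_insert_self])
  · exact hW.trans (Finset.subset_insert _ _)

omit [Fintype V] [Fintype E] [DecidableEq E] [Field R] [LinearOrder R] [IsStrictOrderedRing R] in
/-- **Head-blindness of the chain data from the arc structure**: if every non-entry vertex of
`U` has all its out-arcs inside `U ∪ {a', a}`, the avoidance event of `chainPhi W ∪ X` is that
of `chainPhi (W ∩ ent') ∪ X`. -/
lemma chain_avoid_blind {t : V} (htC : t ∉ insert a (insert a' U)) (ha'U : a' ∉ U)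
    (hout : ∀ v ∈ U, v ∉ ent' → ∀ e, ∀ xy ∈ arcs e, xy.1 = v → xy.2 ∈ insert a (insert a' U))
    {W : Finset V} (hW : W ⊆ U) (X : Finset V) :
    coreAvoidEvent arcs s t (insert a (insert a' U)) (chainPhi ent' a' W ∪ X) =
      coreAvoidEvent arcs s t (insert a (insert a' U)) (chainPhi ent' a' (W ∩ ent') ∪ X) := by
  have hout' : ∀ v ∈ insert a' U, v ∉ insert a' ent' →
      ∀ e, ∀ xy ∈ arcs e, xy.1 = v → xy.2 ∈ insert a (insert a' U) := by
    intro v hv hve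
    rw [Finset.mem_insert] at hv hve
    have hve' := not_or.1 hve
    rcases hv with rfl | hvU
    · exact absurd rfl hve'.1
    · exact hout v hvU hve'.2
  rw [coreAvoidEvent_blind (U := insert a' U) (ent := insert a' ent') (a := a) htC hout'
    (chainPhi_subset_insert hW) X, chainPhi_inter_entries ha'U hW]

/-- **ROW 2′DARC AT THE PURE AND-SWITCH CHAIN WITH HEAD-BLIND NON-ENTRIES.**  `a'` entered from
`ent' ⊆ U` by sure coins, `a` from `a'` by one coin, the cluster law of `U` log-supermodular,
markers `m₁, m₂` anywhere in `U`, every non-entry vertex of `U` with all its out-arcs inside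
`U ∪ {a', a}` (`hout`), `t, w` outside the core.  Contains the covering chain `ent' = U`
(`hout` vacuous) and the §59 instances with a head-blind non-entry marker. -/
theorem darc_of_pureChain_of_blind (pr : E → R) (hp : IsProbVec pr) (hS : SameEnds arcs)
    (h' : OrTailK arcs s U ent' c' a') (hsure' : ∀ r ∈ ent', pr (c' r) = 1)
    (h : OrTailK arcs s (insert a' U) {a'} c a)
    {m₁ m₂ : V} (hm₁ : m₁ ∈ U) (hm₂ : m₂ ∈ U)
    (hν : ∀ W W', W ⊆ U → W' ⊆ U →
      prob pr (coreLevel arcs s U W) * prob pr (coreLevel arcs s U W') ≤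
        prob pr (coreLevel arcs s U (W ∩ W')) * prob pr (coreLevel arcs s U (W ∪ W')))
    {t : V} (htC : t ∉ insert a (insert a' U)) (hts : t ≠ s) (hws : w ≠ s)
    (hwC : w ∉ insert a (insert a' U))
    (hout : ∀ v ∈ U, v ∉ ent' → ∀ e, ∀ xy ∈ arcs e, xy.1 = v → xy.2 ∈ insert a (insert a' U)) :
    DARC pr arcs s {t} m₁ m₂ a w := by
  obtain ⟨hA0, hAmono, hAlsm⟩ := OrTailU.head_props (U := insert a' U) (a := a) pr hp hS t
  obtain ⟨hdc, hd'd, hcc, hdd, hd'd', hdd', -, -, -, hcd, hcd'⟩ :=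
    chainPhi_head_hyps (fun X => prob pr (coreAvoidEvent arcs s t (insert a (insert a' U)) X))
      ent' a' a w hA0 hAmono hAlsm
  have ha'U : a' ∉ U := h'.a_notin
  refine pureChain_darc_of_functional pr hS h' hsure' h hm₁ hm₂ htC hts hws hwC ?_
  -- the chain data restricted to `U`
  set cC := chainC pr arcs s t U ent' a' a with hcC
  set cD := chainD pr arcs s t U ent' a' a with hcD
  set cD' := chainD' pr arcs s t U ent' a' a w with hcD'
  set ν : Finset V → R := fun W => prob pr (coreLevel arcs s U W) with hνdef
  set ct : Finset V → R := fun W => cC (W ∩ U) with hct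
  set dt : Finset V → R := fun W => cD (W ∩ U) with hdt
  set dt' : Finset V → R := fun W => cD' (W ∩ U) with hdt'
  -- blindness of the chain data on `U.powerset`
  have hbC : ∀ W ⊆ U, cC W = cC (W ∩ ent') := fun W hW => by
    simp only [hcC, chainC]
    have := chain_avoid_blind (s := s) htC ha'U hout hW ∅
    rw [Finset.union_empty, Finset.union_empty] at this
    rw [this]
  have hbD : ∀ W ⊆ U, cD W = cD (W ∩ ent') := fun W hW => by
    simp only [hcD, chainD]
    rw [chain_avoid_blind (s := s) htC ha'U hout hW {a}]
  have hbD' : ∀ W ⊆ U, cD' W = cD' (W ∩ ent') := fun W hW => by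
    simp only [hcD', chainD']
    rw [chain_avoid_blind (s := s) htC ha'U hout hW {a, w}]
  have hres : ∀ (f : Finset V → R), (∀ W ⊆ U, f W = f (W ∩ ent')) →
      ∀ W, f (W ∩ U) = f ((W ∩ ent') ∩ U) := fun f hf W => by
    rw [hf (W ∩ U) Finset.inter_subset_right, Finset.inter_right_comm]
  -- the abstract theorem with the virtual vertex `a'`
  have key := pureChain_functional_nonneg_of_blind U ent' a' ha'U ν ct dt dt' (pr (c a'))
    (hp.nonneg _) (hp.le_one _) (fun W => prob_nonneg hp _)
    (fun s' hs' t' ht' => hν s' t' hs' ht')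
    (fun W => hA0 _) (fun W => hA0 _) (fun W => hA0 _)
    (fun W => hdc _) (fun W => hd'd _)
    (fun s' t' => by
      show cC (s' ∩ U) * cC (t' ∩ U) ≤ cC ((s' ∩ t') ∩ U) * cC ((s' ∪ t') ∩ U)
      rw [state_inter, state_union]; exact hcc _ _)
    (fun s' t' => by
      show cD (s' ∩ U) * cD (t' ∩ U) ≤ cD ((s' ∩ t') ∩ U) * cD ((s' ∪ t') ∩ U)
      rw [state_inter, state_union]; exact hdd _ _)
    (fun s' t' => by
      show cD' (s' ∩ U) * cD' (t' ∩ U) ≤ cD' ((s' ∩ t') ∩ U) * cD' ((s' ∪ t') ∩ U)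
      rw [state_inter, state_union]; exact hd'd' _ _)
    (fun s' t' => by
      show cD (s' ∩ U) * cD' (t' ∩ U) ≤ cD ((s' ∩ t') ∩ U) * cD' ((s' ∪ t') ∩ U)
      rw [state_inter, state_union]; exact hdd' _ _)
    (fun s' t' => by
      show cC (s' ∩ U) * cD (t' ∩ U) ≤ cC ((s' ∩ t') ∩ U) * cD ((s' ∪ t') ∩ U)
      rw [state_inter, state_union]; exact hcd _ _)
    (fun s' t' => by
      show cC (s' ∩ U) * cD' (t' ∩ U) ≤ cC ((s' ∩ t') ∩ U) * cD' ((s' ∪ t') ∩ U)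
      rw [state_inter, state_union]; exact hcd' _ _)
    (hres cC hbC) (hres cD hbD) (hres cD' hbD')
    (fun W => if m₁ ∈ W then (1 : R) else 0) (fun W => if m₂ ∈ W then (1 : R) else 0)
    (fun W => by split_ifs <;> norm_num) (fun W => by split_ifs <;> norm_num)
    (fun s' t' => by
      by_cases hm : m₁ ∈ s'
      · rw [if_pos hm, if_pos (Finset.mem_union_left _ hm)]
      · rw [if_neg hm]; split_ifs <;> norm_num)
    (fun s' t' => by
      by_cases hm : m₂ ∈ s'
      · rw [if_pos hm, if_pos (Finset.mem_union_left _ hm)]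
      · rw [if_neg hm]; split_ifs <;> norm_num)
  -- on `U.powerset` the restricted data are the chain data
  have hmixR : ∀ W ∈ U.powerset, chainMix ∅ ent' (pr (c a')) ct dt W =
      chainMix ∅ ent' (pr (c a')) cC cD W := fun W hW => by
    rw [Finset.mem_powerset] at hW
    simp only [chainMix, hct, hdt, Finset.inter_eq_left.mpr hW]
  have hmixG : ∀ W ∈ U.powerset, chainMix ∅ ent' (pr (c a')) ct dt' W =
      chainMix ∅ ent' (pr (c a')) cC cD' W := fun W hW => by
    rw [Finset.mem_powerset] at hW
    simp only [chainMix, hct, hdt', Finset.inter_eq_left.mpr hW]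
  have e1 : ∑ W ∈ U.powerset, ν W * chainMix ∅ ent' (pr (c a')) ct dt W =
      ∑ W ∈ U.powerset, ν W * chainMix ∅ ent' (pr (c a')) cC cD W :=
    Finset.sum_congr rfl fun W hW => by rw [hmixR W hW]
  have e2 : ∀ (J : Finset V → R), ∑ W ∈ U.powerset, ν W * chainMix ∅ ent' (pr (c a')) ct dt W * J W =
      ∑ W ∈ U.powerset, ν W * chainMix ∅ ent' (pr (c a')) cC cD W * J W := fun J =>
    Finset.sum_congr rfl fun W hW => by rw [hmixR W hW]
  have e3 : ∑ W ∈ U.powerset, ν W * chainMix ∅ ent' (pr (c a')) ct dt' W =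
      ∑ W ∈ U.powerset, ν W * chainMix ∅ ent' (pr (c a')) cC cD' W :=
    Finset.sum_congr rfl fun W hW => by rw [hmixG W hW]
  have e4 : ∀ (J : Finset V → R), ∑ W ∈ U.powerset, ν W * chainMix ∅ ent' (pr (c a')) ct dt' W * J W =
      ∑ W ∈ U.powerset, ν W * chainMix ∅ ent' (pr (c a')) cC cD' W * J W := fun J =>
    Finset.sum_congr rfl fun W hW => by rw [hmixG W hW]
  rw [e1, e2, e2, e3, e4, e4, e4] at key
  exact key

/-- **ROW 2′DARC AT THE PURE AND-SWITCH CHAIN OVER AN OUT-TREE CORE WITH HEAD-BLIND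
NON-ENTRIES** — the cluster law of an out-tree core is log-supermodular
(`TreeCore.coreLevel_lsm`). -/
theorem darc_of_pureChainTree_of_blind (pr : E → R) (hp : IsProbVec pr) (hS : SameEnds arcs)
    (h' : OrTailK arcs s U ent' c' a') (hsure' : ∀ r ∈ ent', pr (c' r) = 1)
    (h : OrTailK arcs s (insert a' U) {a'} c a)
    {cT : V → E} {par : V → V} {rk : V → ℕ} (hT : TreeCore arcs s U cT par rk)
    {m₁ m₂ : V} (hm₁ : m₁ ∈ U) (hm₂ : m₂ ∈ U)
    {t : V} (htC : t ∉ insert a (insert a' U)) (hts : t ≠ s) (hws : w ≠ s)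
    (hwC : w ∉ insert a (insert a' U))
    (hout : ∀ v ∈ U, v ∉ ent' → ∀ e, ∀ xy ∈ arcs e, xy.1 = v → xy.2 ∈ insert a (insert a' U)) :
    DARC pr arcs s {t} m₁ m₂ a w :=
  darc_of_pureChain_of_blind pr hp hS h' hsure' h hm₁ hm₂ (hT.coreLevel_lsm pr hp) htC hts hws
    hwC hout

end ChainBlindDarc

end Summit.Ventures.PercRepro2.Coin
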